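import Literature.Analysis.FluidPDE.ElgindiBoundaryClassesZero
import Mathlib.Analysis.Calculus.ParametricIntervalIntegral
import HarnessLib

/-!
# Averaging operators `M_a[g](R,σ) = ∫₀¹ uᵃ g(R,σu) du` and the boundary classes
([Elgindi2021] §7.1: regularity of the `L²` solution at the degenerate boundary `θ = π/2`)

Topic `Literature/Analysis/FluidPDE`. Support file (definitions with bodies and proved theorems, no
named facts) on the proof path of the named fact
`Literature.Analysis.FluidPDE.Elgindi.ElgindiGhoulMasmoudi2021_stabilityCore`
(`ElgindiStabilityDecomposition.lean`). T. M. Elgindi, Ann. of Math. 194 (2021) =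
arXiv:1904.04795, §7.1 Proposition 7.1 (p. 19 of the held text).

The bootstrap at the degenerate end of the strip solves `(σ∂_σ + 3)J = r` by the averaging
operator `J = M₂[r]`, `M_a[g](R,σ) = ∫₀¹ uᵃ g(R,σu) du` (Hadamard's lemma in the variable `σ`).
Here: `M_a` preserves joint continuity up to `σ = 0` (`extZero_avgM`), differentiates as
`∂_σ M_a[g] = M_{a+1}[∂_σ g]` on the strip when `g, ∂_σg` extend continuously to `σ = 0`
(`hasDerivAt_avgM`, `dθ_avgM_eq`), hence `∂_σ^l M_a[r] = M_{a+l}[∂_σ^l r]` and `M_a` maps the class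
`ExtZeroUpTo (π/2) m` (of functions smooth on the strip) to itself (`extZeroUpTo_avgM`).
-/

noncomputable section

open MeasureTheory Set Real Filter Function intervalIntegral
open _root_.Topology
open scoped ContDiff

namespace Literature.Analysis.FluidPDE

namespace Elgindi

/-- **The averaging operator** `M_a[g](R,σ) = ∫₀¹ uᵃ·g̃(R,σu) du` (`g̃ = bext g`, the extension of `g`
to `σ = 0` by its one-sided limit). [folklore] -/
def avgM (a : ℕ) (g : ℝ → ℝ → ℝ) : ℝ → ℝ → ℝ := fun R σ => ∫ u in (0:ℝ)..1, u ^ a * bext g (R, σ * u)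

/-! ### Continuity up to `σ = 0` -/

/-- A continuous function on the slab is bounded on compact sub-slabs. [folklore] -/
theorem exists_bound_on_subslab {c : ℝ} {G : ℝ × ℝ → ℝ} (hG : ContinuousOn G (Ioi 0 ×ˢ Ico 0 c))
    {a b c' : ℝ} (ha : 0 < a) (hc' : c' < c) :
    ∃ B, ∀ p ∈ Icc a b ×ˢ Icc 0 c', |G p| ≤ B := by
  have hK : IsCompact (Icc a b ×ˢ Icc (0:ℝ) c') := isCompact_Icc.prod isCompact_Icc
  have hsub : Icc a b ×ˢ Icc (0:ℝ) c' ⊆ Ioi 0 ×ˢ Ico 0 c := fun p hp => ⟨ha.trans_le hp.1.1, hp.2.1, hp.2.2.trans_lt hc'⟩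
  obtain ⟨B, hB⟩ := hK.exists_bound_of_continuousOn (hG.mono hsub)
  exact ⟨B, fun p hp => by have := hB p hp; rwa [Real.norm_eq_abs] at this⟩

/-- **`M_a[g]` is jointly continuous on the slab `(0,∞) × [0,c)` when `g` extends continuously to
`σ = 0`.** [folklore] -/
theorem continuousOn_avgM {c : ℝ} (a : ℕ) {g : ℝ → ℝ → ℝ} (hg : ExtZero c g) :
    ContinuousOn (uncurry (avgM a g)) (Ioi 0 ×ˢ Ico 0 c) := by
  intro p₀ hp₀
  -- work on a relatively open box around `p₀` with compact closure inside the slab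
  obtain ⟨R₀, σ₀⟩ := p₀
  obtain ⟨hR₀, hσ₀0, hσ₀c⟩ : 0 < R₀ ∧ 0 ≤ σ₀ ∧ σ₀ < c := ⟨hp₀.1, hp₀.2.1, hp₀.2.2⟩
  set c' := (σ₀ + c) / 2
  have hc'c : c' < c := by show (σ₀ + c) / 2 < c; linarith
  have hσc' : σ₀ < c' := by show σ₀ < (σ₀ + c) / 2; linarith
  obtain ⟨B, hB⟩ := exists_bound_on_subslab hg (a := R₀ / 2) (b := 2 * R₀) (c' := c') (by positivity) hc'c
  set S' : Set (ℝ × ℝ) := Ioo (R₀ / 2) (2 * R₀) ×ˢ Ico 0 c'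
  have hS'sub : S' ⊆ Ioi 0 ×ˢ Ico 0 c := fun p hp => ⟨show 0 < p.1 by have := hp.1.1; linarith, hp.2.1, hp.2.2.trans hc'c⟩
  have hmem : ((R₀, σ₀) : ℝ × ℝ) ∈ S' := ⟨⟨by linarith, by linarith⟩, hσ₀0, hσc'⟩
  have hev : ∀ᶠ x in 𝓝[Ioi 0 ×ˢ Ico 0 c] ((R₀, σ₀) : ℝ × ℝ), x ∈ S' := by
    have hN : Ioo (R₀ / 2) (2 * R₀) ×ˢ Iio c' ∈ 𝓝 ((R₀, σ₀) : ℝ × ℝ) :=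
      (isOpen_Ioo.prod isOpen_Iio).mem_nhds ⟨⟨by linarith, by linarith⟩, hσc'⟩
    filter_upwards [inter_mem_nhdsWithin (Ioi 0 ×ˢ Ico 0 c) hN] with q hq
    exact ⟨hq.2.1, hq.1.2.1, hq.2.2⟩
  have hF : ∀ x ∈ S', ∀ u ∈ Icc (0:ℝ) 1, (x.1, x.2 * u) ∈ Icc (R₀ / 2) (2 * R₀) ×ˢ Icc 0 c' := by
    intro x hx u hu
    refine ⟨⟨hx.1.1.le, hx.1.2.le⟩, mul_nonneg hx.2.1 hu.1, ?_⟩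
    calc x.2 * u ≤ x.2 * 1 := mul_le_mul_of_nonneg_left hu.2 hx.2.1
      _ ≤ c' := by rw [mul_one]; exact hx.2.2.le
  have hFS : ∀ x ∈ S', ∀ u ∈ Icc (0:ℝ) 1, (x.1, x.2 * u) ∈ Ioi 0 ×ˢ Ico 0 c := fun x hx u hu => by
    have h := hF x hx u hu
    exact ⟨show 0 < x.1 by have := h.1.1; linarith, h.2.1, h.2.2.trans_lt hc'c⟩
  -- the integrand along the segment is continuous, for `x ∈ S'`
  have hseg : ∀ x ∈ S', ContinuousOn (fun u : ℝ => u ^ a * bext g (x.1, x.2 * u)) (Icc 0 1) := by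
    intro x hx
    refine (continuousOn_id.pow a).mul (hg.comp (continuous_const.prodMk (continuous_const.mul continuous_id)).continuousOn
      fun u hu => hFS x hx u hu)
  show ContinuousWithinAt (fun x : ℝ × ℝ => ∫ u in (0:ℝ)..1, u ^ a * bext g (x.1, x.2 * u)) (Ioi 0 ×ˢ Ico 0 c) (R₀, σ₀)
  refine continuousWithinAt_of_dominated_interval (bound := fun _ => |B|) ?_ ?_ ?_ ?_
  · filter_upwards [hev] with x hx
    have : uIoc (0:ℝ) 1 ⊆ Icc 0 1 := by rw [uIoc_of_le zero_le_one]; exact Ioc_subset_Icc_self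
    exact ((hseg x hx).mono this).aestronglyMeasurable measurableSet_uIoc
  · filter_upwards [hev] with x hx
    refine ae_of_all _ fun u hu => ?_
    have hu' : u ∈ Icc (0:ℝ) 1 := by rw [uIoc_of_le zero_le_one] at hu; exact Ioc_subset_Icc_self hu
    rw [Real.norm_eq_abs, abs_mul, abs_pow, abs_of_nonneg hu'.1]
    calc u ^ a * |bext g (x.1, x.2 * u)| ≤ 1 ^ a * |B| :=
          mul_le_mul (pow_le_pow_left₀ hu'.1 hu'.2 a) ((hB _ (hF x hx u hu')).trans (le_abs_self B)) (abs_nonneg _) (by positivity)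
      _ = |B| := by rw [one_pow, one_mul]
  · exact intervalIntegrable_const
  · refine ae_of_all _ fun u hu => ?_
    have hu' : u ∈ Icc (0:ℝ) 1 := by rw [uIoc_of_le zero_le_one] at hu; exact Ioc_subset_Icc_self hu
    have hpath : ContinuousWithinAt (fun x : ℝ × ℝ => ((x.1, x.2 * u) : ℝ × ℝ)) (Ioi 0 ×ˢ Ico 0 c) (R₀, σ₀) :=
      (continuous_fst.prodMk (continuous_snd.mul continuous_const)).continuousWithinAt
    have hmaps : MapsTo (fun x : ℝ × ℝ => ((x.1, x.2 * u) : ℝ × ℝ)) (Ioi 0 ×ˢ Ico 0 c) (Ioi 0 ×ˢ Ico 0 c) := by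
      intro x hx
      refine ⟨hx.1, mul_nonneg hx.2.1 hu'.1, ?_⟩
      calc x.2 * u ≤ x.2 * 1 := mul_le_mul_of_nonneg_left hu'.2 hx.2.1
        _ < c := by rw [mul_one]; exact hx.2.2
    have hgx : ContinuousWithinAt (bext g) (Ioi 0 ×ˢ Ico 0 c) ((fun x : ℝ × ℝ => ((x.1, x.2 * u) : ℝ × ℝ)) (R₀, σ₀)) :=
      hg _ (hmaps (x := (R₀, σ₀)) hp₀)
    have hcomp : ContinuousWithinAt (fun x : ℝ × ℝ => bext g (x.1, x.2 * u)) (Ioi 0 ×ˢ Ico 0 c) (R₀, σ₀) :=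
      ContinuousWithinAt.comp (f := fun x : ℝ × ℝ => ((x.1, x.2 * u) : ℝ × ℝ)) (x := (R₀, σ₀)) hgx hpath hmaps
    exact continuousWithinAt_const.mul hcomp

/-- **`M_a` preserves the class `ExtZero`.** [folklore] -/
theorem extZero_avgM {c : ℝ} (hc : 0 < c) (a : ℕ) {g : ℝ → ℝ → ℝ} (hg : ExtZero c g) : ExtZero c (avgM a g) := by
  refine extZero_of_continuousOn hc (g₀ := fun R => avgM a g R 0) ?_
  refine (continuousOn_avgM a hg).congr fun p hp => ?_
  by_cases h0 : p.2 ≤ 0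
  · have hz : p.2 = 0 := le_antisymm h0 hp.2.1
    rw [if_pos h0]; show avgM a g p.1 0 = avgM a g p.1 p.2; rw [hz]
  · rw [if_neg h0]; rfl

/-! ### Differentiation: `∂_σ M_a[g] = M_{a+1}[∂_σ g]` on the strip -/

/-- Slices of a function smooth on the strip, along `σ ↦ (R, σu)`. [folklore] -/
theorem hasDerivAt_slice_scaled {g : ℝ → ℝ → ℝ} (hgs : ContDiffOn ℝ ∞ (uncurry g) strip) {R σ u : ℝ}
    (hR : 0 < R) (hσu : σ * u ∈ Ioo 0 (π / 2)) :
    HasDerivAt (fun σ' => g R (σ' * u)) (u * dθ g R (σ * u)) σ := by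
  have hp : (R, σ * u) ∈ strip := ⟨hR, hσu⟩
  have hd : DifferentiableAt ℝ (uncurry g) (R, σ * u) := differentiableAt_of_contDiffOn_strip (contDiffOn_nat_of_infty hgs 1) (by simp) hp
  -- the `θ`-slice derivative
  have hc : HasDerivAt (fun θ' : ℝ => (R, θ')) ((0 : ℝ), (1 : ℝ)) (σ * u) := (hasDerivAt_const _ R).prodMk (hasDerivAt_id _)
  have h1 := hd.hasFDerivAt.comp_hasDerivAt (σ * u) hc
  have e : (fun θ' => g R θ') = uncurry g ∘ fun θ' => (R, θ') := rfl
  have hslice : HasDerivAt (fun θ' => g R θ') (dθ g R (σ * u)) (σ * u) := by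
    show HasDerivAt (fun θ' => g R θ') (deriv (fun θ' => g R θ') (σ * u)) (σ * u)
    rw [e, h1.deriv]; exact h1
  -- compose with `σ' ↦ σ' u`
  have hlin : HasDerivAt (fun σ' : ℝ => σ' * u) u σ := by simpa using (hasDerivAt_id σ).mul_const u
  have := hslice.comp σ hlin
  refine this.congr_deriv ?_; ring

/-- **`∂_σ M_a[g](R,σ) = M_{a+1}[∂_σ g](R,σ)` at every point of the strip**, when `g` is `C^∞` on the
strip and `g, ∂_σg` extend continuously to `σ = 0` (on `σ < π/2`). [folklore] -/
theorem hasDerivAt_avgM (a : ℕ) {g : ℝ → ℝ → ℝ} (hgs : ContDiffOn ℝ ∞ (uncurry g) strip)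
    (hg : ExtZero (π / 2) g) (hg1 : ExtZero (π / 2) (dθ g)) {p : ℝ × ℝ} (hp : p ∈ strip) :
    HasDerivAt (fun σ => avgM a g p.1 σ) (avgM (a + 1) (dθ g) p.1 p.2) p.2 := by
  obtain ⟨R, σ₀⟩ := p
  obtain ⟨hR, hσ₀, hσ₀π⟩ : 0 < R ∧ 0 < σ₀ ∧ σ₀ < π / 2 := ⟨hp.1, hp.2.1, hp.2.2⟩
  simp only
  -- the parameter neighbourhood `s = (σ₀/2, c₁)`, `c₁ = (σ₀ + π/2)/2`
  set c₁ := (σ₀ + π / 2) / 2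
  have hc₁ : c₁ < π / 2 := by show (σ₀ + π / 2) / 2 < π / 2; linarith
  have hσc₁ : σ₀ < c₁ := by show σ₀ < (σ₀ + π / 2) / 2; linarith
  set s : Set ℝ := Ioo (σ₀ / 2) c₁
  have hs : s ∈ 𝓝 σ₀ := Ioo_mem_nhds (by linarith) hσc₁
  have hs0 : ∀ σ ∈ s, 0 < σ := fun σ hσ => by have := hσ.1; linarith
  -- bounds for `bext g` and `bext (∂_σ g)` on `{R} × [0, c₁]`
  obtain ⟨B₀, hB₀⟩ := exists_bound_on_subslab hg (a := R) (b := R) (c' := c₁) hR hc₁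
  obtain ⟨B₁, hB₁⟩ := exists_bound_on_subslab hg1 (a := R) (b := R) (c' := c₁) hR hc₁
  have hseg : ∀ {σ u : ℝ}, σ ∈ s → u ∈ Icc (0:ℝ) 1 → ((R, σ * u) : ℝ × ℝ) ∈ Icc R R ×ˢ Icc 0 c₁ := by
    intro σ u hσ hu
    refine ⟨⟨le_rfl, le_rfl⟩, mul_nonneg (hs0 σ hσ).le hu.1, ?_⟩
    calc σ * u ≤ σ * 1 := mul_le_mul_of_nonneg_left hu.2 (hs0 σ hσ).le
      _ ≤ c₁ := by rw [mul_one]; exact hσ.2.le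
  have hpos : ∀ {σ u : ℝ}, σ ∈ s → u ∈ Ioc (0:ℝ) 1 → σ * u ∈ Ioo 0 (π / 2) := fun {σ u} hσ hu =>
    ⟨mul_pos (hs0 σ hσ) hu.1, by
      calc σ * u ≤ σ * 1 := mul_le_mul_of_nonneg_left hu.2 (hs0 σ hσ).le
        _ < π / 2 := by rw [mul_one]; exact hσ.2.trans hc₁⟩
  -- the integrands
  set F : ℝ → ℝ → ℝ := fun σ u => u ^ a * bext g (R, σ * u)
  set F' : ℝ → ℝ → ℝ := fun σ u => u ^ (a + 1) * bext (dθ g) (R, σ * u)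
  have hcontF : ∀ σ ∈ s, ContinuousOn (F σ) (Icc 0 1) := fun σ hσ =>
    (continuousOn_id.pow a).mul (hg.comp (continuous_const.prodMk (continuous_const.mul continuous_id)).continuousOn
      fun u hu => ⟨hR, (hseg hσ hu).2.1, (hseg hσ hu).2.2.trans_lt hc₁⟩)
  have hcontF' : ∀ σ ∈ s, ContinuousOn (F' σ) (Icc 0 1) := fun σ hσ =>
    (continuousOn_id.pow (a + 1)).mul (hg1.comp (continuous_const.prodMk (continuous_const.mul continuous_id)).continuousOn
      fun u hu => ⟨hR, (hseg hσ hu).2.1, (hseg hσ hu).2.2.trans_lt hc₁⟩)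
  have hσ₀s : σ₀ ∈ s := ⟨by linarith, hσc₁⟩
  have hIoc : uIoc (0:ℝ) 1 = Ioc 0 1 := uIoc_of_le zero_le_one
  have key := intervalIntegral.hasDerivAt_integral_of_dominated_loc_of_deriv_le (μ := volume) (a := 0) (b := 1)
    (F := F) (F' := F') (x₀ := σ₀) (bound := fun _ => |B₁|) hs ?_ ?_ ?_ ?_ ?_ ?_
  · -- identify the derivative with `M_{a+1}[∂_σ g]`
    have e : ∫ u in (0:ℝ)..1, F' σ₀ u = avgM (a + 1) (dθ g) R σ₀ := rfl
    rw [e] at key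
    exact key.2
  · filter_upwards [hs] with σ hσ
    exact ((hcontF σ hσ).mono (by rw [hIoc]; exact Ioc_subset_Icc_self)).aestronglyMeasurable measurableSet_uIoc
  · exact (hcontF σ₀ hσ₀s).intervalIntegrable_of_Icc zero_le_one
  · exact ((hcontF' σ₀ hσ₀s).mono (by rw [hIoc]; exact Ioc_subset_Icc_self)).aestronglyMeasurable measurableSet_uIoc
  · refine ae_of_all _ fun u hu σ hσ => ?_
    rw [hIoc] at hu
    have hu' : u ∈ Icc (0:ℝ) 1 := Ioc_subset_Icc_self hu
    show |u ^ (a + 1) * bext (dθ g) (R, σ * u)| ≤ |B₁|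
    rw [abs_mul, abs_pow, abs_of_nonneg hu'.1]
    calc u ^ (a + 1) * |bext (dθ g) (R, σ * u)| ≤ 1 ^ (a + 1) * |B₁| :=
          mul_le_mul (pow_le_pow_left₀ hu'.1 hu'.2 _) ((hB₁ _ (hseg hσ hu')).trans (le_abs_self _)) (abs_nonneg _) (by positivity)
      _ = |B₁| := by rw [one_pow, one_mul]
  · exact intervalIntegrable_const
  · refine ae_of_all _ fun u hu σ hσ => ?_
    rw [hIoc] at hu
    -- on `s`, `σ' ↦ bext g (R, σ'u) = g R (σ'u)` near `σ`
    have hσu := hpos hσ hu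
    have hder : HasDerivAt (fun σ' => g R (σ' * u)) (u * dθ g R (σ * u)) σ := hasDerivAt_slice_scaled hgs hR hσu
    have hev : (fun σ' => bext g (R, σ' * u)) =ᶠ[𝓝 σ] fun σ' => g R (σ' * u) := by
      have : ∀ᶠ σ' in 𝓝 σ, 0 < σ' * u := by
        have hc : ContinuousAt (fun σ' : ℝ => σ' * u) σ := (continuous_id.mul continuous_const).continuousAt
        exact hc.eventually (lt_mem_nhds hσu.1)
      filter_upwards [this] with σ' hσ'
      exact bext_of_pos g (p := (R, σ' * u)) hσ'
    have h2 : HasDerivAt (fun σ' => bext g (R, σ' * u)) (u * dθ g R (σ * u)) σ := hder.congr_of_eventuallyEq hev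
    have h3 := h2.const_mul (u ^ a)
    have eF' : F' σ u = u ^ a * (u * dθ g R (σ * u)) := by
      show u ^ (a + 1) * bext (dθ g) (R, σ * u) = _
      rw [bext_of_pos (dθ g) (p := (R, σ * u)) hσu.1, pow_succ]; ring
    rw [eF']
    exact h3

/-- **`∂_σ M_a[g] = M_{a+1}[∂_σ g]` on the strip** (as `dθ`, the derivative in the second variable). [folklore] -/
theorem dθ_avgM_eq (a : ℕ) {g : ℝ → ℝ → ℝ} (hgs : ContDiffOn ℝ ∞ (uncurry g) strip)
    (hg : ExtZero (π / 2) g) (hg1 : ExtZero (π / 2) (dθ g)) {p : ℝ × ℝ} (hp : p ∈ strip) :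
    dθ (avgM a g) p.1 p.2 = avgM (a + 1) (dθ g) p.1 p.2 :=
  (hasDerivAt_avgM a hgs hg hg1 hp).deriv

/-! ### Iteration and the classes -/

/-- **`∂_σ^l M_a[r] = M_{a+l}[∂_σ^l r]` on the strip** for `r ∈ C^∞(strip)` with
`r ∈ ExtZeroUpTo (π/2) l`. [folklore] -/
theorem iterate_dθ_avgM_eq {r : ℝ → ℝ → ℝ} (hrs : ContDiffOn ℝ ∞ (uncurry r) strip) :
    ∀ (l a : ℕ), ExtZeroUpTo (π / 2) l r → ∀ p ∈ strip, (dθ^[l] (avgM a r)) p.1 p.2 = avgM (a + l) (dθ^[l] r) p.1 p.2 := by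
  intro l
  induction l with
  | zero => intro a _ p _; rfl
  | succ l ih =>
    intro a hr p hp
    have hr' : ExtZeroUpTo (π / 2) l r := hr.of_le (Nat.le_succ l)
    -- `dθ^[l+1] (M_a r) = dθ (dθ^[l] (M_a r)) = dθ (M_{a+l} (dθ^[l] r))` by locality
    rw [Function.iterate_succ_apply']
    rw [eqOn_dθ (f := dθ^[l] (avgM a r)) (g := avgM (a + l) (dθ^[l] r)) isOpen_strip (fun q hq => ih a hr' q hq) hp]
    -- differentiate once more
    have hls : ContDiffOn ℝ ∞ (uncurry (dθ^[l] r)) strip := by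
      clear ih hr hr' hp
      induction l with
      | zero => exact hrs
      | succ l ih2 => rw [Function.iterate_succ_apply']; exact contDiffOn_dθ_strip ih2
    have h0 : ExtZero (π / 2) (dθ^[l] r) := hr l (Nat.le_succ l)
    have h1 : ExtZero (π / 2) (dθ (dθ^[l] r)) := by rw [← Function.iterate_succ_apply' dθ l r]; exact hr (l + 1) le_rfl
    rw [dθ_avgM_eq (a + l) hls h0 h1 hp, Function.iterate_succ_apply', show a + (l + 1) = a + l + 1 by ring]

/-- Iterated `∂_θ` preserves `C^∞(strip)`. [folklore] -/
theorem contDiffOn_iterate_dθ_strip {g : ℝ → ℝ → ℝ} (hg : ContDiffOn ℝ ∞ (uncurry g) strip) (l : ℕ) :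
    ContDiffOn ℝ ∞ (uncurry (dθ^[l] g)) strip := by
  induction l with
  | zero => exact hg
  | succ l ih => rw [Function.iterate_succ_apply']; exact contDiffOn_dθ_strip ih

/-- **`M_a` maps `ExtZeroUpTo (π/2) m` (of functions smooth on the strip) to itself.** [folklore] -/
theorem extZeroUpTo_avgM (a m : ℕ) {r : ℝ → ℝ → ℝ} (hrs : ContDiffOn ℝ ∞ (uncurry r) strip)
    (hr : ExtZeroUpTo (π / 2) m r) : ExtZeroUpTo (π / 2) m (avgM a r) := by
  intro l hl
  have hl' : ExtZeroUpTo (π / 2) l r := hr.of_le hl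
  rw [extZero_congr le_rfl (iterate_dθ_avgM_eq hrs l a hl')]
  exact extZero_avgM (by positivity) (a + l) (hr l hl)

end Elgindi

end Literature.Analysis.FluidPDE
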